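import Summits.RiemannHypothesis.RiemannHypothesis.Theses.WeilParity

/-!
# `OffLineParityDetection` (crux stmt-RiemannHypothesis-15431, route WeilParity) — the stubs of the
# picked line `registered`: immunity of LOC / INF, load-bearing hypotheses of TORUS

Negative lemmas from the standing disprover (refuter-cdisprove-stmt-RiemannHypothesis-15431-0, cycle 1)
about the three OPEN registered stubs of `Cruxes/OffLineParityDetection/Lines/birth.lean`
(skeleton ac8a92b9; BOHR is landed, p152991).  Every statement is INLINED verbatim from the
registered stub signature (no new definitions):

* `stubFiniteDefectLocalisation_immune`, `stubInfiniteDefectDetection_immune`: the hypotheses of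
  LOC (`T = {ζ = 0, Re = 1/2 + η₀}` nonempty, `η₀ > 0`) and of INF (the off-line set is infinite)
  already contain an off-line zero of `ζ`, so both stubs hold vacuously under RH and a refutation
  of either one would disprove the Riemann Hypothesis — like the crux itself they are unrefutable
  short of `¬RH`, and all killable content of the line sits in the ζ-free stub TORUS;
* `stubTorusTopHeavy_false_without_weightPos`, `stubTorusTopHeavy_false_without_nonempty`: in TORUS
  the strict positivity of the weights cannot be weakened to `0 ≤ w` and `T.Nonempty` cannot be
  dropped (the gain clause `(D + δ)∫f² ≤ gain` dies when the gain vanishes identically).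

Axioms: propext, Classical.choice, Quot.sound.
-/

noncomputable section

namespace Summit.RiemannHypothesis.RiemannHypothesis.Theorems.WeilParity.OffLineParityDetection.Negative

-- `Summit.RiemannHypothesis.RiemannHypothesis.…` repeats a namespace component by design (D-0017 layout).
set_option linter.dupNamespace false

open Set MeasureTheory Complex
open Literature.NumberTheory.LFunctions

/-- Under RH there is no zero of `ζ` with `0 < Re ρ < 1`, `Re ρ ≠ 1/2` (Mathlib's binder: the
trivial zeros have `Re ≤ -2`, and `ρ ≠ 1` since `Re ρ < 1`). [folklore] -/
theorem not_exists_offLine_of_riemannHypothesis (h : RiemannHypothesis) :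
    ¬ ∃ ρ : ℂ, riemannZeta ρ = 0 ∧ 0 < ρ.re ∧ ρ.re < 1 ∧ ρ.re ≠ 1 / 2 := by
  rintro ⟨ρ, hζ, h0, h1, hne⟩
  refine hne (h ρ hζ ?_ ?_)
  · rintro ⟨n, rfl⟩
    have : (-2 * ((n : ℂ) + 1)).re = -2 * (n + 1) := by simp
    rw [this] at h0
    have hn : (0 : ℝ) ≤ n := n.cast_nonneg
    linarith
  · rintro rfl
    simp at h1

/-- **Stub LOC (`stub_finiteDefectLocalisation`) is immune**: its hypotheses exhibit a zero of
real part `1/2 + η₀ > 1/2` (any member of the nonempty top layer `T`), which lies in the open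
strip (`re_lt_one_of_riemannZeta_eq_zero`); hence a refutation of LOC disproves RH. [folklore] -/
theorem stubFiniteDefectLocalisation_immune
    (h : ¬ ∀ hS : ({ρ : ℂ | riemannZeta ρ = 0 ∧ 0 < ρ.re ∧ ρ.re < 1 ∧ ρ.re ≠ 1 / 2}).Finite,
      ∀ η₀ : ℝ, 0 < η₀ →
      (∀ ρ : ℂ, riemannZeta ρ = 0 → 0 < ρ.re → ρ.re < 1 → ρ.re ≠ 1 / 2 → |ρ.re - 1 / 2| ≤ η₀) →
      ∀ T : Finset ℂ, (∀ ρ : ℂ, ρ ∈ T ↔ (riemannZeta ρ = 0 ∧ ρ.re = 1 / 2 + η₀)) → T.Nonempty →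
      ∀ δ : ℝ, 0 < δ → ∀ f₀ : ℝ → ℝ, ContDiff ℝ (⊤ : ℕ∞) f₀ → HasCompactSupport f₀ →
      tsupport f₀ ⊆ Set.Ici 0 → 0 < ∫ u in Set.Ioi (0 : ℝ), f₀ u ^ 2 →
      (∃ᶠ a : ℝ in Filter.atTop, ∃ D : ℝ, 0 ≤ D ∧
        (∀ f : ℝ → ℝ, ContDiff ℝ (⊤ : ℕ∞) f → HasCompactSupport f → tsupport f ⊆ Set.Ici 0 →
          -(∑ ρ ∈ T, (riemannZetaZeroOrder ρ : ℝ) *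
              (Complex.exp (2 * (ρ.im : ℂ) * (a : ℂ) * Complex.I) *
              (∫ u in Set.Ioi (0 : ℝ), (f u : ℂ) * Complex.exp (-((ρ - 1 / 2) * (u : ℂ)))) ^ 2).re)
            ≤ D * ∫ u in Set.Ioi (0 : ℝ), f u ^ 2) ∧
        (D + δ) * ∫ u in Set.Ioi (0 : ℝ), f₀ u ^ 2 ≤
          ∑ ρ ∈ T, (riemannZetaZeroOrder ρ : ℝ) *
            (Complex.exp (2 * (ρ.im : ℂ) * (a : ℂ) * Complex.I) *
            (∫ u in Set.Ioi (0 : ℝ), (f₀ u : ℂ) * Complex.exp (-((ρ - 1 / 2) * (u : ℂ)))) ^ 2).re) →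
      ∃ a : ℝ, 0 < a ∧ ∃ o : ℝ → ℂ, IsWeilTest o ∧ tsupport o ⊆ Set.Icc (-a) a ∧
        (∀ t, o (-t) = -o t) ∧ ∫ t, ‖o t‖ ^ 2 = (1 : ℝ) ∧ ∃ m : ℝ, 0 < m ∧
        ∀ e : ℝ → ℂ, IsWeilTest e → tsupport e ⊆ Set.Icc (-a) a → (∀ t, e (-t) = e t) →
          (∀ t, (e t).im = 0) → ∫ t, ‖e t‖ ^ 2 = (1 : ℝ) →
          (weilQuadratic o).re + m ≤ (weilQuadratic e).re) :
    ¬ RiemannHypothesis := by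
  intro hRH
  apply h
  intro hS η₀ hη₀ hbd T hT hTne
  exfalso
  obtain ⟨ρ, hρ⟩ := hTne
  obtain ⟨hz, hre⟩ := (hT ρ).1 hρ
  exact not_exists_offLine_of_riemannHypothesis hRH
    ⟨ρ, hz, by linarith, re_lt_one_of_riemannZeta_eq_zero hz, by linarith⟩

/-- **Stub INF (`stub_infiniteDefectDetection`) is immune**: its hypothesis makes the off-line set
infinite, in particular nonempty; hence a refutation of INF disproves RH. [folklore] -/
theorem stubInfiniteDefectDetection_immune
    (h : ¬ (({ρ : ℂ | riemannZeta ρ = 0 ∧ 0 < ρ.re ∧ ρ.re < 1 ∧ ρ.re ≠ 1 / 2}).Infinite →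
      ∃ a : ℝ, 0 < a ∧ ∃ x : ℝ, weilOddGroundEnergy a < x ∧
        ∀ e : ℝ → ℂ, IsWeilTest e → tsupport e ⊆ Set.Icc (-a) a → (∀ t, e (-t) = e t) →
          (∀ t, (e t).im = 0) → ∫ t, ‖e t‖ ^ 2 = (1 : ℝ) → x ≤ (weilQuadratic e).re)) :
    ¬ RiemannHypothesis := by
  intro hRH
  apply h
  intro hinf
  exfalso
  obtain ⟨ρ, hζ, h0, h1, hne⟩ := hinf.nonempty
  exact not_exists_offLine_of_riemannHypothesis hRH ⟨ρ, hζ, h0, h1, hne⟩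

/-- **Strict positivity of some weight is load-bearing in TORUS (`stub_torusTopHeavy`)**: with the
hypothesis `∀ ρ ∈ T, 0 < w ρ` weakened to `0 ≤ w ρ` the statement is FALSE — witness `η₀ = 1`,
`T = {3/2}`, `w = 0`: the gain vanishes identically, so `(D + δ)∫f² ≤ 0 < (D + δ)∫f²`. [folklore] -/
theorem stubTorusTopHeavy_false_without_weightPos :
    ¬ ∀ η₀ : ℝ, 0 < η₀ → ∀ T : Finset ℂ, T.Nonempty → (∀ ρ ∈ T, ρ.re = 1 / 2 + η₀) →
      ∀ w : ℂ → ℝ, (∀ ρ ∈ T, 0 ≤ w ρ) →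
      ∃ δ : ℝ, 0 < δ ∧ ∃ a : ℝ, ∃ D : ℝ, 0 ≤ D ∧
        (∀ f : ℝ → ℝ, ContDiff ℝ (⊤ : ℕ∞) f → HasCompactSupport f → tsupport f ⊆ Set.Ici 0 →
          -(∑ ρ ∈ T, w ρ * (Complex.exp (2 * (ρ.im : ℂ) * (a : ℂ) * Complex.I) *
              (∫ u in Set.Ioi (0 : ℝ), (f u : ℂ) * Complex.exp (-((ρ - 1 / 2) * (u : ℂ)))) ^ 2).re)
            ≤ D * ∫ u in Set.Ioi (0 : ℝ), f u ^ 2) ∧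
        (∃ f : ℝ → ℝ, ContDiff ℝ (⊤ : ℕ∞) f ∧ HasCompactSupport f ∧ tsupport f ⊆ Set.Ici 0 ∧
          0 < ∫ u in Set.Ioi (0 : ℝ), f u ^ 2 ∧
          (D + δ) * ∫ u in Set.Ioi (0 : ℝ), f u ^ 2 ≤
            ∑ ρ ∈ T, w ρ * (Complex.exp (2 * (ρ.im : ℂ) * (a : ℂ) * Complex.I) *
              (∫ u in Set.Ioi (0 : ℝ), (f u : ℂ) * Complex.exp (-((ρ - 1 / 2) * (u : ℂ)))) ^ 2).re) := by
  intro h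
  obtain ⟨δ, hδ, a, D, hD, -, f, -, -, -, hfpos, hgain⟩ :=
    h 1 one_pos {(3 / 2 : ℂ)} (Finset.singleton_nonempty _)
      (fun ρ hρ ↦ by rw [Finset.mem_singleton.1 hρ]; norm_num) (fun _ ↦ 0) (fun _ _ ↦ le_rfl)
  simp only [zero_mul, Finset.sum_const_zero] at hgain
  nlinarith

/-- **`T.Nonempty` is load-bearing in TORUS (`stub_torusTopHeavy`)**: with it dropped the statement
is FALSE — witness `T = ∅` (empty gain). [folklore] -/
theorem stubTorusTopHeavy_false_without_nonempty :
    ¬ ∀ η₀ : ℝ, 0 < η₀ → ∀ T : Finset ℂ, (∀ ρ ∈ T, ρ.re = 1 / 2 + η₀) →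
      ∀ w : ℂ → ℝ, (∀ ρ ∈ T, 0 < w ρ) →
      ∃ δ : ℝ, 0 < δ ∧ ∃ a : ℝ, ∃ D : ℝ, 0 ≤ D ∧
        (∀ f : ℝ → ℝ, ContDiff ℝ (⊤ : ℕ∞) f → HasCompactSupport f → tsupport f ⊆ Set.Ici 0 →
          -(∑ ρ ∈ T, w ρ * (Complex.exp (2 * (ρ.im : ℂ) * (a : ℂ) * Complex.I) *
              (∫ u in Set.Ioi (0 : ℝ), (f u : ℂ) * Complex.exp (-((ρ - 1 / 2) * (u : ℂ)))) ^ 2).re)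
            ≤ D * ∫ u in Set.Ioi (0 : ℝ), f u ^ 2) ∧
        (∃ f : ℝ → ℝ, ContDiff ℝ (⊤ : ℕ∞) f ∧ HasCompactSupport f ∧ tsupport f ⊆ Set.Ici 0 ∧
          0 < ∫ u in Set.Ioi (0 : ℝ), f u ^ 2 ∧
          (D + δ) * ∫ u in Set.Ioi (0 : ℝ), f u ^ 2 ≤
            ∑ ρ ∈ T, w ρ * (Complex.exp (2 * (ρ.im : ℂ) * (a : ℂ) * Complex.I) *
              (∫ u in Set.Ioi (0 : ℝ), (f u : ℂ) * Complex.exp (-((ρ - 1 / 2) * (u : ℂ)))) ^ 2).re) := by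
  intro h
  obtain ⟨δ, hδ, a, D, hD, -, f, -, -, -, hfpos, hgain⟩ :=
    h 1 one_pos ∅ (fun ρ hρ ↦ absurd hρ (Finset.notMem_empty _)) (fun _ ↦ 1)
      (fun ρ hρ ↦ absurd hρ (Finset.notMem_empty _))
  simp only [Finset.sum_empty] at hgain
  nlinarith

end Summit.RiemannHypothesis.RiemannHypothesis.Theorems.WeilParity.OffLineParityDetection.Negative

end
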